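import Mathlib
import HarnessLib
import HarnessLib.Audit
import Summits.HubbardSuperconductivity.Statement
import Literature.MathematicalPhysics.QuantumLattice.DWaveSource
import Literature.Barriers.HubbardSuperconductivity.PureModelStripeCompetition

/-!
Route: OneSidedBootstrap

CLOSED (retired) 2026-08-15T13:48:20Z by operator:999:1257524 — reason: not-a-thesis: assembly does not conclude the sub-problem Statement — note: D-0027 §2.1 audit (human 2026-08-15: routes that do not decide the summit are removed): the assembly concludes `StripePointCeiling`, not the sub-problem statement; a NEW conforming route may be opened from the same idea (generated `closes : … → _root_.HubbardSuperconductivity`).. The file is kept as the record of this route; refuted decls are indexed as negative knowledge (`ledger negatives`).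

# Route OneSidedBootstrap — Absence is certifiable — SDP ceiling on the sourced d-wave order
parameter over t.i. pseudo-ground-states + Kaplan–Horsch–von der Linden/Koma–Tasaki ⇒ every-GS
d-wave LRO ceiling at (8, 1/8)

NEGATIVE SIDE, CEILING ROUTE (card one-sided-certifiability-nogo-bootstrap; stated plainly: a finite
certificate bounds order from
ABOVE, it never certifies exact absence, so the target is an every-ground-state ceiling at the
catalogued stripe point, not ¬S).
It suffices to show X := StripeSourceCeiling ∧ SourcedOrderDominatesLRO ∧
CanonicalSupportingPotential, where
(X1, the bet, crux 2) at every chemical potential μ that canonically supports (U, δ) = (8, 1/8) —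
i.e. the (N_L, S^z=0)-sector
ground energy of hubbardTorus 2 L 1 8, N_L = 2⌊(7/8)L²/2⌋, exceeds μN_L +
groundEnergy(hubbardTorusWith 2 L 1 8 μ) by o(L²) along
even L — the finite-volume Koma–Tasaki d-wave order parameter m_L(h) := dWaveSourceDensity L 8 μ h =
Re ω₀^{L,h}(P)/L² (tracial
ground-state functional of the SOURCED grand-canonical torus Hamiltonian dWaveSourceTorus L 8 μ h =
H − μN − h(P + P†),
P = pairField dWaveFormFactor L = √2·Δ_d) satisfies m_L(h) ≤ 1/20 for all h ∈ (0, h₀) and all L ≥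
L₀(h);
(X2, the engine, crux 3) LRO FORCES SOURCED ORDER (Kaplan–Horsch–von der Linden / Koma–Tasaki, the
theorem direction): for any real U, μ,
if normalised sector ground states ψ_L have Re⟨ψ_L, P†P ψ_L⟩ ≥ c·L⁴ eventually along even L (c > 0)
and their sectors are supported
by μ as above, then for every h > 0 and ε > 0, m_L(h) ≥ √(c/2) − ε eventually along even L;
(X3, support) a supporting μ exists for every (U, δ) (T = 0 equivalence of ensembles).
TARGET StripePointCeiling: every admissible ground-state sequence of the pure model at (U, δ) = (8,
1/8) has eventual d-wave
pair-field LRO density ≤ 1/200 in P-units, i.e. liminf_{L even} L⁻⁴⟨ψ_L, Δ_d†Δ_d ψ_L⟩ ≤ 1/400: every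
S-witness (8, 1/8, c) of
the summit's matrix has c ≤ 1/400. X1 is discharged (layer 2) by a finite RATIONAL one-point
certificate found by the
state-optimality / NPA semidefinite relaxation over translation-invariant pseudo-ground-states — the
side of the summit on which a
finite local certificate is informative (a MAXIMUM of Re ω̃(P₀) over a convex set containing all
U(1)-averages and twisted states
bounds every true sourced ground state; a minimum is always 0).
Lean: `StripeSourceCeiling ∧ SourcedOrderDominatesLRO ∧ CanonicalSupportingPotential`

## Assembly
Pure logic, PROVED sorry-free in the planner's Sketch.lean (`stripePointCeiling_of`, lean check rc
0): given an admissible sequence at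
(8, 1/8) and an eventual lower bound c > 1/200, √(c/2) > 1/20; take μ from
CanonicalSupportingPotential at (8, 1/8) (the floor formula
rewrites N_L), h = h₀/2 from StripeSourceCeiling, ε = (√(c/2) − 1/20)/2 in SourcedOrderDominatesLRO,
and the even side
L = 2·max(L₀, L₀′) + 2: √(c/2) − ε ≤ m_L(h) ≤ 1/20, contradiction. SourceSlopeBound and
SsbReadingOfStripeNoGo are off-chain supports
(the former is an ingredient of crux 3's proof, the latter the qualitative corollary linking the
route to NoGo / PlateauExclusion / the
barrier entry).

UNDER FLOOR: fewer than 2 cruxes remain after retriage (legacy route; D-0019).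

Rationale: WHY THIS LINE. Two facts sat side by side in this sub-problem without being joined. (i) The
direction LRO ⇒ SSB is a THEOREM: a sector ground state
with pair-field LRO σ² yields, by one symmetry-broken trial state Ξ = (ψ + Oψ/‖Oψ‖)/√2
(KaplanHorschVonDerLinden1989) or by the Koma–Tasaki
tower (KomaTasaki1994 §2, §3.4; KomaTasaki1993), a lower bound on the ground-state response to the
pair source −h(P + P†) — in the tree's
own objects, dWaveSourceDensity of DWaveSource.lean — so ANY upper bound η on the sourced d-wave
order parameter is an every-ground-state
ceiling LRO_P ≤ 2η²; this is exactly the step the barrier entry PureModelStripeCompetition records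
as "assumed, not proved" between
Qin et al.'s extrapolated Δ(h_p) → 0.003(6) at μ = 1.75 (QinEtAl2020 p. 9) and the summit's LRO
language. (ii) The sourced one-point
function IS boundable by a finite certificate: the tracial ground-state functional of the sourced
torus Hamiltonian is, for every
L larger than the certificate's range, translation invariant, positive, and satisfies the
first-order optimality rows ω(a†[H,a]) ≥ 0,
ω([H,b]) = 0 — precisely the constraints of the state-optimality SDP hierarchies (AraujoEtAl2023
§6.1 bounds magnetisations over the SET
of t.i. ground states of Heisenberg models this way; WangEtAl2024, FawziFawziScalet2024,
KullEtAl2024, arXiv:2410.00810), whose dual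
solutions are sums of squares plus KKT and translation-coboundary terms checkable in exact
arithmetic. Imported area: non-commutative
polynomial optimisation / SDP duality (certified computation), grafted onto finite-size SSB theory
(mathematical physics); no physical
analogy is used as evidence. What prior routes do not do: NoGo's NogoStripeWindow has "no rigorous
tool"; PlateauExclusion needs a
certified pair INCOMPRESSIBILITY (a gap) at commensurate sides; CoboundaryCeiling is a state-free
linear residual with no positivity cone;
GSCertificate/KacWindowPenalty work the positive side, where U(1) twists defeat finite local
certificates — here the obstruction is
one-sided and absent.

RANKED CRUXES. #0 StripePointCeiling (target) — every admissible sequence at (U, δ) = (8, 1/8) — N_L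
= 2⌊(1 − 1/8)L²/2⌋ and ψ_L a normalised (N_L, S^z=0)-sector ground state of hubbardTorus 2 L 1 8 at
even L — obeys: every eventual lower bound c·L⁴ ≤ Re⟨ψ_L, P†P ψ_L⟩ along even L (P = pairField
dWaveFormFactor L) has c ≤ 1/200. Since P = √2Δ_d and Σ_{x,y∈halfOpenBox} torusPullback
(pairFieldCorr dWaveFormFactor ψ) L x y = Re⟨ψ_L, P†P ψ_L⟩, this says liminf L⁻⁴⟨Δ_d†Δ_d⟩ ≤ 1/400
for every ground-state sequence: any S-witness at the catalogued stripe point has Scalapino constant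
≤ 1/400 (bond singlet amplitude ≤ 1/80 per bond in Qin et al.'s normalisation, below the t′ = −0.2
model's 0.017(3)). (why it might fail: Holds iff the maximal Koma–Tasaki d-wave order parameter at
(8, μ(1/8)) is < 1/20 in P-units (AFQMC central value 4·0.003(6) ≈ 0.012); false if the pure model
at 1/8 is an RVB/t′-level superconductor (m ≳ 0.07: Sorella2023, MaierEtAl2005 dissent).)
[QinEtAl2020, XuEtAl2024, Sorella2023, MaierEtAl2005,
Literature.Barriers.HubbardSuperconductivity.PureModelStripeCompetition]
#2 StripeSourceCeiling (crux) — (card K1, typed without the SDP objects) for every μ that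
canonically supports (8, 1/8) [|minEnergyOn (szSector N_L 0) (hubbardTorus 2 L 1 8) − μN_L −
groundEnergy (hubbardTorusWith 2 L 1 8 μ)| ≤ εL² eventually along even L, every ε > 0] there is h₀ >
0 such that for all h ∈ (0, h₀) and all L ≥ L₀(h): dWaveSourceDensity L 8 μ h ≤ 1/20. Discharge path
(layer 2, after the definition request lands): a degree-R ONE-POINT CERTIFICATE — L-independent
box-supported CAR polynomials s_j (SOS), a_k (KKT multipliers), b, and (x_i, B_i) (translation
coboundaries) with 1/20·1 − (P₀ + P₀†)/2 = Σ s_j†s_j + Σ a_k†[H_{L,μ,h}, a_k] + [H_{L,μ,h}, b] + Σ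
(τ_{x_i}B_i − B_i) on Fock((ℤ/Lℤ)²) for all L ≥ L₀, H_{L,μ,h} = dWaveSourceTorus L 8 μ h, P₀ =
localPair dWaveFormFactor L 0 — evaluated in the tracial sourced ground-state functional (positive,
translation invariant, ω(a†[H,a]) ≥ 0, ω([H,b]) = 0) it gives m_L(h) ≤ 1/20; found by the
state-optimality / NPA SDP with rational rounding, uniform on the (μ, h)-box by SOS multipliers (μ,
h, U enter the rows affinely). [difficulty: XL] (why it might fail: The relaxation must price out
d-wave pseudo-states only ≈0.01t/site above the stripe state (QinEtAl2020 §III.C);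
2-positivity-level fermionic constraints are far too loose at U=8 (VerstichelEtAl2012), so the
needed range R may be out of reach — or m(8, μ) > 1/20 in truth.) [QinEtAl2020, AraujoEtAl2023,
WangEtAl2024, FawziFawziScalet2024, KullEtAl2024, VerstichelEtAl2012, arXiv:2410.00810,
doi:10.1103/physrevlett.108.213001]
#3 SourcedOrderDominatesLRO (crux) — (card P1/F1 in sourced finite-volume form; the engine) for all
real U, μ, every N : ℕ → ℕ and normalised (N_L, S^z=0)-sector ground states ψ_L of hubbardTorus 2 L
1 U (even L) whose sectors are supported by μ [o(L²) grand-canonical excess as in crux 2]: if c·L⁴ ≤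
Re⟨ψ_L, P†P ψ_L⟩ for all even L ≥ L₀ (c > 0) then for every h > 0 and ε > 0, √(c/2) − ε ≤
dWaveSourceDensity L U μ h for all even L ≥ L₀′. Hence dWaveOrderParameter U μ ≥ √(c/2), and
contrapositively any bound η on the sourced order parameter is the every-ground-state ceiling LRO_P
≤ 2η². Proof sketch (one trial state, no tower, no reflection positivity): O = P + P†, Ξ = (ψ +
Oψ/‖Oψ‖)/√2 is a unit vector with ⟨Ξ,OΞ⟩ = ‖Oψ‖ = (2Re⟨P†P⟩ + ⟨[P,P†]⟩)^{1/2} ≥ (2cL⁴ − C₁L²)^{1/2}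
because ⟨O⟩ = ⟨O³⟩ = 0 in a particle-number eigenstate; ⟨Ξ,(H − μN)Ξ⟩ − (E_sec − μN_L) = ⟨ψ,[[O, H −
μN], O]ψ⟩/(2‖Oψ‖²) ≤ C₂(U,μ)L²/(4cL⁴) (double commutator of finite-range sums); the variational
principle for groundEnergy (dWaveSourceTorus L U μ h) ≤ ⟨Ξ,(H − μN − hO)Ξ⟩ and SourceSlopeBound give
L²·m_L(h) ≥ ⟨Ξ,OΞ⟩/2 − [C₂/(4cL²) + g_L(μ)]/(2h) with g_L(μ) = E_sec − μN_L − E₀^{gc}(μ) = o(L²).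
[deps: SourceSlopeBound] [difficulty: L] (why it might fail: As typed: bond pair densities overlap
(KT hypothesis i) fails), so ‖[[O,H−μN],O]‖ ≤ C·L² and ‖[P,P†]‖ ≤ C·L² need a locality recount; the
o(L²) ensemble clause and groundEnergy/minEnergyOn junk values at empty sectors must be fenced. On
paper it is KHvdL 1989 / KT 1994 §3.4.) [KaplanHorschVonDerLinden1989, KomaTasaki1994,
KomaTasaki1993, doi:10.1007/bf02097237, HorschVonDerLinden1988, Tasaki1998,
Literature.Barriers.HubbardSuperconductivity.LROForcesLowLyingStates,
Literature.MathematicalPhysics.QuantumLattice.dWaveSourceDensity]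
#9 SourceSlopeBound (support) — for every L, U, μ and h > 0: (groundEnergy (dWaveSourceTorus L U μ
0) − groundEnergy (dWaveSourceTorus L U μ h))/(2h) ≤ L²·dWaveSourceDensity L U μ h = Re ω₀^{L,h}(P).
Proof: h ↦ E_L(h) = λ_min(H_μ − hO) is concave (infimum of affine functions); its left derivative at
h is −λ_min of O compressed to the ground space of H_μ − hO (first-order degenerate perturbation
theory), which is ≤ the tracial average ω₀^{L,h}(O) = 2 Re ω₀^{L,h}(P); the supergradient inequality
gives (E_L(0) − E_L(h))/h ≤ −E_L′(h−). Abstract matrix lemma worth landing on its own: Hermitian A,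
O and h > 0 ⇒ (λ_min(A) − λ_min(A − hO))/h ≤ Re (Matrix.groundStateFunctional (A − hO) O).
[difficulty: provable-now] [KaplanHorschVonDerLinden1989, Griffiths1966, Kato1966, Tasaki2020]
#9 CanonicalSupportingPotential (support) — (T = 0 equivalence of ensembles for the Hubbard torus)
for every real U and δ ∈ (0,1) there is μ such that |minEnergyOn (szSector N_L 0) (hubbardTorus 2 L
1 U) − μ·N_L − groundEnergy (hubbardTorusWith 2 L 1 U μ)| ≤ εL² for all even L ≥ L₀(ε), N_L = 2⌊(1 −
δ)L²/2⌋. Proof: existence of the ground-state energy density e(ρ) = lim E_L(N_L(ρ))/L² (block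
decomposition of the torus, boundary hopping costs O(L), sector energies are C-Lipschitz in N), its
convexity (two half-tori), groundEnergy(H − μN)/L² → min_ρ (e(ρ) − μρ), and μ any subgradient of e
at 1 − δ (all subgradients lie in [−4, 4 + U⁺] since e(0) = 0 with slope −4 at 0⁺ and slope ≤ 4 + U⁺
at 2⁻). The S^z = 0 restriction is immaterial (N_L even ⇒ every spin multiplet of the N_L-sector
ground space has an S^z = 0 member). Library value beyond this route: the canonical ↔
grand-canonical dictionary every sourced-order-parameter route (WeakCouplingBCS, ChiralWindow,
AposterioriCapRg) silently needs. [difficulty: M] [Ruelle1969, Simon1993, Griffiths1966, LiebWu1968]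
#9 SsbReadingOfStripeNoGo (support) — (the Koma–Tasaki reading of the catalogued stripe no-go, as a
theorem schema) if at every canonical supporting potential μ of (8, 1/8) the sourced d-wave order
parameter vanishes in the finite-volume sense — ∀ η > 0 ∃ h₀ > 0 ∀ h ∈ (0, h₀) ∃ L₀ ∀ L ≥ L₀:
dWaveSourceDensity L 8 μ h ≤ η — then PureModelStripeCompetition (= ¬HasDWavePairFieldLROAt 8 (1/8))
holds; in fact NO admissible sequence at (8, 1/8) has d-wave pair-field LRO. Follows from
SourcedOrderDominatesLRO + CanonicalSupportingPotential + the LRO normal form Σ_{x,y∈halfOpenBox 2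
(2k)} torusPullback (pairFieldCorr dWaveFormFactor ψ) (2k) x y = Re⟨ψ_{2k}, P†P ψ_{2k}⟩ + existence
of admissible sequences (Theorems/NoGoNogoThesis exists_groundStateInSector_seq) + liminf ⇒
eventually bookkeeping. This is the step the barrier entry's scope caveat records as 'assumed, not
proved'. [difficulty: M] [KomaTasaki1994, KaplanHorschVonDerLinden1989, QinEtAl2020,
Literature.Barriers.HubbardSuperconductivity.PureModelStripeCompetition]

TWO-LAYER PLAN. Foreseen glued splits (nothing filed now beyond the informal items named in §
Definition requests):
StripeSourceCeiling ⇐ OnePointSoundness → StripeOnePointCertificate → PotentialBracket →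
StripeSourceCeiling (k = 3), once the
definition DWaveOnePointCertificate lands — OnePointSoundness (provable then: a certificate of level
R at (U, μ, h, η) gives
dWaveSourceDensity L U μ h ≤ η for all L ≥ L₀(R): positivity of ω₀(s†s), ω₀(a†[H,a]) ≥ 0 and
ω₀([H,b]) = 0 for the tracial ground-state
functional of the finite Hermitian matrix H = dWaveSourceTorus L U μ h, translation invariance of ω₀
because H commutes with torus
translations, and Re ω₀(P)/L² = Re ω₀(P₀)); StripeOnePointCertificate (certified computation: ∃ R,
h₀ with a certificate at
(8, μ, h, 1/20) for all μ ∈ [μ₁, μ₂], h ∈ (0, h₀)); PotentialBracket (every supporting μ of (8, 1/8)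
lies in [μ₁, μ₂]; a priori
[−4, 12], sharpened by certified energy bounds). SourcedOrderDominatesLRO ⇐ TrialStateOrder (⟨Ξ,OΞ⟩,
⟨O³⟩ = 0, ‖[P,P†]‖ ≤ C L²) →
DoubleCommutatorBudget (‖[[O, H − μN], O]‖ ≤ C(U,μ)L², the same count
PlateauExclusion.PairGapCeiling and CoboundaryCeiling.CeilingLemma
need — share it via --supports) → glue with SourceSlopeBound (k = 2). Second deployment of the
engine, not filed: the Nagaoka corner
U ≥ U₁, δ ≤ δ₁ (card K2), where the maximiser should be ferromagnetic-like with tiny singlet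
amplitude.

KILL CRITERIA. (a) StripeSourceCeiling refuted — some supporting μ with m_L(h) > 1/20 persistently
(a certified LOWER bound on the sourced order
parameter, or a proof of d-wave LRO > 1/400 at (8, 1/8), which also refutes the target) ⇒ close
`refuted:StripeSourceCeiling`: the pure
model then superconducts at 1/8 at t′-level strength; hand the point to S-side routes. (b) PRACTICAL
kill (the card's fastest
refutation): floating-point η_R(8, μ ≈ 1.75, h ≈ 0.01–0.05) at the largest feasible level (3×3 /
4×4-site boxes, KKT degree ≥ 3) not
visibly below its U = 2 value, or ≥ 0.3 ⇒ the hierarchy cannot resolve the competition scale: close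
`exhausted`, keeping
SourcedOrderDominatesLRO, SourceSlopeBound, CanonicalSupportingPotential, SsbReadingOfStripeNoGo as
shared support (they serve NoGo,
PlateauExclusion, ChiralWindow, AposterioriCapRg regardless) and recording the certified-but-weak
η_R as a support statement.
(c) SourcedOrderDominatesLRO refuted AS TYPED ⇒ restate once (it is KHvdL/KT on paper; a refutation
exposes a typing slip — junk values,
the ensemble clause); a second refutation closes the route. (d) CanonicalSupportingPotential is a
theorem of thermodynamics; if its
Lean cost explodes, restate crux 2 over an explicit μ-bracket and carry the ensemble clause as a
hypothesis of the target (pivot, not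
close).

NOT DECOMPOSED YET. The certificate object (definition request at open), its soundness lemma and the
certified computation (informal items at open, typed
once the definition lands); the symmetry reduction of the SDP (translations × axis reflections ×
SU(2) × spin flip; the B1g source is odd
under the 90° rotation, so use rotation∘(U(1) phase π)); the μ-bracket; the SHARP constant LRO_P ≤
m² (KT (2.30) via the tower — needs
the overlapping-support variant of theorem_2_3 / Theorem 2.5; a ceiling does not need it); the box
version U ∈ [6, 8] × δ ∈ [1/10, 1/6]
(U affine in the rows ⇒ SOS-in-U multipliers); the Nagaoka corner (card K2); infinite-volume
completeness η_R ↓ max SSB amplitude over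
t.i. ground states (Fawzi–Fawzi–Scalet-type convergence + Bratteli–Kishimoto–Robinson) — reassuring,
never load-bearing for a ceiling;
calibration theorems at U = 0 (sourced free gas, BdG blocks: WeakCouplingBCS support
WcbcsSourcedFreeGasCooperLog) and U < 0;
the restatement of crux 2 over the INTERIOR of the supporting interval should a coexistence endpoint
μ± of a 7/8-plateau also support a
superconducting density outside the stripe window (then the sourced grand-canonical functional sees
that density, not 7/8).

CHEAPEST FALSIFIER. (i) Typing: `lean check` of folder/Sketch.lean — done, rc 0, seven decls + the
assembly step `stripePointCeiling_of` proved without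
sorry. (ii) The line: one floating-point run of the one-point SDP at level (2×2-site box, KKT degree
2) and (3×2) at
(U, μ, h) = (8, 1.75, 0.05) against (2, μ_free(7/8), 0.05) and against the exactly solvable U = 0
sourced free gas (BdG blocks): if
η_R(8) is not below η_R(2) and below ≈ 0.3, kill (b) fires before any Lean is written (kit job; not
run in this one-shot planning
session). (iii) Lookup: is the sourced inequality for lattice-fermion PAIR fields with overlapping
bond densities in print with
constants (KT 1994 §3.4 only says "with some extra care")? If yes crux 3 downgrades to support — the
route survives either way.

NUMBERS. Normalisations: P = pairField dWaveFormFactor L = Σ_x localPair = √2·Δ_d (Statement.lean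
docstring); localPair P_x = Σ_{e=±e₁,±e₂} g_d(e) b_{x,x+e}
with b_{ij} = (c_{i↑}c_{j↓} − c_{i↓}c_{j↑})/√2 = Qin et al.'s Δ̂_ij (arXiv:1910.08931 Eq. (2)), so m
:= Re ω(P₀) = 4·Δ_bond; our source
−h(P + P†) = −2h Σ_bonds ±(b + b†) vs their −Σ h_p(Δ̂ + Δ̂†)/2 (Eq. (5)) ⇒ h_p = 4h. AFQMC at U = 8:
"The chemical potential μ = 1.75 is
chosen such that the hole density is h = 1/8" (p. 9); Δ_∞(0) = 0.003(6) (p. 9, Fig. 9) ⇒ m ≈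
0.012(24). t′ = −0.2, hole doping 1/8:
Δ = 0.017(3) (arXiv:2303.08376 SM p. 14) ⇒ m ≈ 0.068. Threshold 1/20 on m ⇔ Δ_bond ≤ 0.0125: below
the t′-model superconductor, 4× above
the pure-model central value. Target ceiling: LRO_P ≤ 2·(1/20)² = 1/200 ⇔ liminf L⁻⁴⟨Δ_d†Δ_d⟩ ≤
1/400. Competition scale the SDP must
resolve: stripe vs uniform d-wave ≈ 0.01t per site (QinEtAl2020 §III.C, Fig. 10); certified SDP
energy windows today: a few per cent of
|e₀| (WangEtAl2024 2D Heisenberg; KullEtAl2024). A-priori potential bracket: subgradients of e on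
(0, 2) lie in [−4, 4 + U] = [−4, 12].
Items at open: 7 typed (1 target, 2 cruxes, 3 supports, 1 assembly) + 2 informal statements + 1
definition request.

DEFINITION REQUESTS. DWaveOnePointCertificate (R : ℕ) (U μ h η : ℝ) — NEW OBJECT posited for this
problem (topic Summits/HubbardSuperconductivity/HubbardSuperconductivity/Theorems;
cf. the positive-side interface of route GSCertificate): L-independent finite data — polynomials in
the torus CAR generators supported
in translates of the R-box: SOS generators s_j, KKT multipliers a_k, an arbitrary b, translation
coboundaries (x_i, B_i), and L₀ — such
that for every L ≥ L₀ the operator identity η·1 − (P₀ + P₀†)/2 = Σ_j s_j†s_j + Σ_k a_k†(H a_k − a_k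
H) + (H b − b H) + Σ_i (τ_{x_i}(B_i) − B_i)
holds on Fock((ℤ/Lℤ)²) with H = dWaveSourceTorus L U μ h and P₀ = localPair dWaveFormFactor L 0 (τ =
torus translation of orbitals).
Filed at open with `ledger workitem add --kind definition`; then two informal statement items:
OnePointSoundness [support:
Nonempty (DWaveOnePointCertificate R U μ h η) → ∀ L ≥ L₀, dWaveSourceDensity L U μ h ≤ η] and
StripeOnePointCertificate [crux, rank 4,
certified computation: ∃ R h₀ μ₁ μ₂ bracketing the supporting potentials of (8, 1/8), ∀ μ ∈ [μ₁,
μ₂], ∀ h ∈ (0, h₀),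
Nonempty (DWaveOnePointCertificate R 8 μ h (1/20))]. No Literature fact is requested: the sourced
inequality is crux 3, to be PROVED.

Novelty: Searches (2026-08-15): `lit read paper:arxiv-cond-mat_9708132` (KT 1994: §2 Thms 2.2–2.5, Cor. 2.9,
§2.7 Remark 2 p. 11 "existence of a
symmetry breaking in the [sourced] state … proved in [KaplanHorschLinden, KomaTasaki]", §3.4 lattice
electrons "with some extra care");
`lit read paper:arxiv-1910.08931` pp. 4, 9 and `lit read arxiv:2303.08376` SM p. 14 (numbers above);
`lit search --source crossref` ×6:
"Kaplan Horsch von der Linden order parameter …" (doi:10.1143/jpsj.58.3894,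
doi:10.1103/physrevb.42.4663), "Koma Tasaki symmetry breaking
Heisenberg antiferromagnets" (doi:10.1007/bf02097237, doi:10.1103/physrevlett.70.93), "certified
bounds superconducting order parameter
Hubbard semidefinite reduced density matrix" (10 rows: 2-RDM SDPs doi:10.1063/1.1360199,
doi:10.1103/physreva.73.062505,
doi:10.1103/physrevb.50.6519 — variational energies, no certified upper bound on an SSB amplitude),
"Verstichel … 2D Hubbard"
(doi:10.1103/physrevlett.108.213001), "noncommutative polynomial optimization ground state local
observables bounds" (10 rows, none on
order parameters of lattice fermions), "absence of superconducting long-range order ground state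
Hubbard rigorous upper bound"
(doi:10.1016/s0375-9601(97)00204-1 Su–Schadschneider–Zittartz, doi:10.1103/physrevb.45.3145 Tian —
Bogoliubov-inequality no-go needing a
gap / negative-U exact ODLRO); `lit vsearch` ×3 (sourced order parameter vs LRO; SDP certified
bounds on observables — 10 held BOOKS each, none relevant: Fradkin,
Altland–S  [refs: 10.1143/jpsj.58.3894, 10.1103/physrevb.42.4663, 10.1007/bf02097237, 10.1103/physrevlett.70.93, 10.1063/1.1360199, 10.1103/physreva.73.062505, 10.1103/physrevb.50.6519, 10.1103/physrevlett.108.213001, 10.1016/s0375-9601(97, 10.1103/physrevb.45.3145, 10.1103/PhysRevX.14.031006, 2303.08376, 2311.18707, 2410.00810, paper:arxiv-cond-mat_9708132, paper:arxiv-1910.08931, arxiv:2303.08376, doi:10.1143/jps]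

Barriers (technique_class: SDP-bootstrap-upper-bound, Koma-Tasaki-contrapositive): - technique_class: SDP-bootstrap-upper-bound, Koma-Tasaki-contrapositive
- Literature.Barriers.HubbardSuperconductivity.PureModelStripeCompetition: not fought but
instrumented — this route is the tool that moves the catalogued NUMERICAL obstruction (Δ_∞(0) =
0.003(6) at μ = 1.75) toward theorems: its KT reading (SsbReadingOfStripeNoGo) becomes provable and
its quantitative shadow (StripePointCeiling) certifiable; the entry's 'contested' status
(Sorella2023, MaierEtAl2005) is the why-might-fail of StripeSourceCeiling.
- Literature.Barriers.HubbardSuperconductivity.SignProblemNPHard: evaded in kind — no sampling; a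
deterministic SDP whose dual certificate is verified in exact arithmetic; NP-hardness of generic
ground-state problems returns only as slow convergence in the level R (kill (b)), never as an
uncontrolled bias.
- Literature.Barriers.HubbardSuperconductivity.LROForcesLowLyingStates: USED in the theorem
direction (LRO ⇒ a low-lying symmetry-broken trial state ⇒ sourced order), with its scope caveat
respected: nothing infers LRO from SSB (KT Conj. 10 stays open and unused); the failure of KT's
hypothesis i) for overlapping bond pair densities is flagged as crux 3's why-might-fail.
- Literature.Barriers.HubbardSuperconductivity.GeneralizedHartreeFockNoPairing: irrelevant to
validity — no quasi-free variational class is assumed; BCS-like pseudo-states are feasible points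
that KKT rows of degree ≥ 3 must price out (it predicts that degree-2 relaxations are loose, cf.
Versti

History (route lifecycle, newest last):
- 2026-08-15T13:48:20Z · CLOSED retired — not-a-thesis: assembly does not conclude the sub-problem Statement (operator:999:1257524)

sub-problem: HubbardSuperconductivity · status: closed(retired) · opened planner-plancard-HubbardSuperconductivity-Hub-6df3989b-0 2026-08-15T12:32:39Z · rev 1 · ledger route-HubbardSuperconductivity-OneSidedBootstrap
GENERATED by the gate from the ledger (D-0016/17). Provers cite these decls: `theorem foo : Summit.HubbardSuperconductivity.HubbardSuperconductivity.Theses.OneSidedBootstrap.<Decl> := …` in Summits/HubbardSuperconductivity/HubbardSuperconductivity/Theorems/<Name>.lean.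
-/

namespace Summit.HubbardSuperconductivity.HubbardSuperconductivity.Theses.OneSidedBootstrap

open scoped BigOperators Topology Manifold Classical MeasureTheory ProbabilityTheory Matrix InnerProductSpace ComplexConjugate ContinuousMap
open Filter Set Function TopologicalSpace MeasureTheory

attribute [summit_statement] _root_.HubbardSuperconductivity

open Literature.Hubbard

/-- item stmt-HubbardSuperconductivity-8181 · target · rank 0 · closed · moot by None · by planner
why it might fail: False iff some GS sequence of the pure model at (8,1/8) has d-wave LRO c>1/200 (m≈√c>0.07 = t′=−0.2-level pairing 0.017/bond): AFQMC gives c≈(0.012)²≈1.4e-4 (QinEtAl2020 p.9, Δ∞(0)=0.003(6)) but the point is contested (MaierEtAl2005 DCA; ArovasBergKivelsonRaghu2022 §8.1 'unsettled').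
sources: QinEtAl2020, XuEtAl2024, MaierEtAl2005, Sorella2023, ArovasBergKivelsonRaghu2022, Literature.Barriers.HubbardSuperconductivity.PureModelStripeCompetition
[target] every admissible sequence at (U, δ) = (8, 1/8) — N_L = 2⌊(1 − 1/8)L²/2⌋ and ψ_L a
normalised (N_L, S^z=0)-sector ground state of hubbardTorus 2 L 1 8 at even L — obeys: every
eventual lower bound c·L⁴ ≤ Re⟨ψ_L, P†P ψ_L⟩ along even L (P = pairField dWaveFormFactor L) has c ≤
1/200. Since P = √2Δ_d and Σ_{x,y∈halfOpenBox} torusPullback (pairFieldCorr dWaveFormFactor ψ) L x y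
= Re⟨ψ_L, P†P ψ_L⟩, this says liminf L⁻⁴⟨Δ_d†Δ_d⟩ ≤ 1/400 for every ground-state sequence: any
S-witness at the catalogued stripe point has Scalapino constant ≤ 1/400 (bond singlet amplitude ≤
1/80 per bond in Qin et al.'s normalisation, below the t′ = −0.2 model's 0.017(3)). -/
@[route_item "route-HubbardSuperconductivity-OneSidedBootstrap"]
def StripePointCeiling : Prop :=
  ∀ (N : ℕ → ℕ) (ψ : ∀ L, Literature.MathematicalPhysics.QuantumLattice.Fock (Literature.MathematicalPhysics.QuantumLattice.Orb (Literature.MathematicalPhysics.QuantumLattice.FermionTorus 2 L))), (∀ L, Even L → N L = 2 * ⌊(1 - 1 / 8) * (L : ℝ) ^ 2 / 2⌋₊ ∧ star (ψ L) ⬝ᵥ ψ L = 1 ∧ Literature.MathematicalPhysics.QuantumLattice.IsGroundStateInSector (Literature.MathematicalPhysics.QuantumLattice.hubbardTorus 2 L 1 8) (N L) 0 (ψ L)) → ∀ c : ℝ, (∃ L₀ : ℕ, ∀ (L : ℕ) [NeZero L], Even L → L₀ ≤ L → c * (L : ℝ) ^ 4 ≤ (Literature.MathematicalPhysics.QuantumLattice.expect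 (Matrix.conjTranspose (Literature.MathematicalPhysics.QuantumLattice.pairField Literature.MathematicalPhysics.QuantumLattice.dWaveFormFactor L) * Literature.MathematicalPhysics.QuantumLattice.pairField Literature.MathematicalPhysics.QuantumLattice.dWaveFormFactor L) (ψ L)).re) → c ≤ 1 / 200

/-- item stmt-HubbardSuperconductivity-8182 · crux · rank 2 · closed · moot by None · by planner
why it might fail: m may exceed 1/20: AFQMC Δ∞(0)=0.003(6)/bond ⇒ m=0.012±0.024, 1.6σ margin (QinEtAl2020 p.9); '∀ supporting μ' includes ∂e(7/8) endpoints — μ(1/8)=1.75 abuts the stripe-filling boundary μopt≈1.73 (abrupt density jump, maximal SC response, p.16); SDP must resolve 0.01t/site at U=8.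
sources: QinEtAl2020, VerstichelEtAl2012, AraujoEtAl2023, WangEtAl2024, FawziFawziScalet2024, KullEtAl2024
[crux] (card K1, typed without the SDP objects) for every μ that canonically supports (8, 1/8)
[|minEnergyOn (szSector N_L 0) (hubbardTorus 2 L 1 8) − μN_L − groundEnergy (hubbardTorusWith 2 L 1
8 μ)| ≤ εL² eventually along even L, every ε > 0] there is h₀ > 0 such that for all h ∈ (0, h₀) and
all L ≥ L₀(h): dWaveSourceDensity L 8 μ h ≤ 1/20. Discharge path (layer 2, after the definition
request lands): a degree-R ONE-POINT CERTIFICATE — L-independent box-supported CAR polynomials s_j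
(SOS), a_k (KKT multipliers), b, and (x_i, B_i) (translation coboundaries) with 1/20·1 − (P₀ +
P₀†)/2 = Σ s_j†s_j + Σ a_k†[H_{L,μ,h}, a_k] + [H_{L,μ,h}, b] + Σ (τ_{x_i}B_i − B_i) on Fock((ℤ/Lℤ)²)
for all L ≥ L₀, H_{L,μ,h} = dWaveSourceTorus L 8 μ h, P₀ = localPair dWaveFormFactor L 0 — evaluated
in the tracial sourced ground-state functional (positive, translation invariant, ω(a†[H,a]) ≥ 0,
ω([H,b]) = 0) it gives m_L(h) ≤ 1/20; found by the state-optimality / NPA SDP with rational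
rounding, uniform on the (μ, h)-box by SOS multipliers (μ, h, U enter the rows affinely).
[difficulty: XL] -/
@[route_item "route-HubbardSuperconductivity-OneSidedBootstrap"]
def StripeSourceCeiling : Prop :=
  ∀ μ : ℝ, (∀ ε : ℝ, 0 < ε → ∃ L₀ : ℕ, ∀ L : ℕ, Even L → L₀ ≤ L → |(Literature.MathematicalPhysics.QuantumLattice.hubbardTorus 2 L 1 8).minEnergyOn (Literature.MathematicalPhysics.QuantumLattice.szSector (2 * ⌊(1 - 1 / 8) * (L : ℝ) ^ 2 / 2⌋₊) 0) - μ * ((2 * ⌊(1 - 1 / 8) * (L : ℝ) ^ 2 / 2⌋₊ : ℕ) : ℝ) - Matrix.groundEnergy (Literature.MathematicalPhysics.QuantumLattice.hubbardTorusWith 2 L 1 8 μ)| ≤ ε * (L : ℝ) ^ 2) → ∃ h₀ : ℝ, 0 < h₀ ∧ ∀ h : ℝ, h ∈ Set.Ioo (0:ℝ) h₀ → ∃ L₀ : ℕ, ∀ (L : ℕ) [NeZero L], L₀ ≤ L → Literature.MathematicalPhysics.QuantumLattice.dWaveSourceDensity L 8 μ h ≤ 1 / 20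

/-- item stmt-HubbardSuperconductivity-8183 · support · rank 3 · closed · moot by None · by planner
why it might fail: As typed: bond pair densities overlap (KT hypothesis i) fails), so ‖[[O,H−μN],O]‖ ≤ C·L² and ‖[P,P†]‖ ≤ C·L² need a locality recount; the o(L²) ensemble clause and groundEnergy/minEnergyOn junk values at empty sectors must be fenced. On paper it is KHvdL 1989 / KT 1994 §3.4.
sources: KaplanHorschVonDerLinden1989, Tasaki2019Tower, KomaTasaki1994, KomaTasaki1993, HorschVonDerLinden1988, Literature.Barriers.HubbardSuperconductivity.LROForcesLowLyingStates
[crux] (card P1/F1 in sourced finite-volume form; the engine) for all real U, μ, every N : ℕ → ℕ and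
normalised (N_L, S^z=0)-sector ground states ψ_L of hubbardTorus 2 L 1 U (even L) whose sectors are
supported by μ [o(L²) grand-canonical excess as in crux 2]: if c·L⁴ ≤ Re⟨ψ_L, P†P ψ_L⟩ for all even
L ≥ L₀ (c > 0) then for every h > 0 and ε > 0, √(c/2) − ε ≤ dWaveSourceDensity L U μ h for all even
L ≥ L₀′. Hence dWaveOrderParameter U μ ≥ √(c/2), and contrapositively any bound η on the sourced
order parameter is the every-ground-state ceiling LRO_P ≤ 2η². Proof sketch (one trial state, no
tower, no reflection positivity): O = P + P†, Ξ = (ψ + Oψ/‖Oψ‖)/√2 is a unit vector with ⟨Ξ,OΞ⟩ =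
‖Oψ‖ = (2Re⟨P†P⟩ + ⟨[P,P†]⟩)^{1/2} ≥ (2cL⁴ − C₁L²)^{1/2} because ⟨O⟩ = ⟨O³⟩ = 0 in a particle-number
eigenstate; ⟨Ξ,(H − μN)Ξ⟩ − (E_sec − μN_L) = ⟨ψ,[[O, H − μN], O]ψ⟩/(2‖Oψ‖²) ≤ C₂(U,μ)L²/(4cL⁴)
(double commutator of finite-range sums); the variational principle for groundEnergy
(dWaveSourceTorus L U μ h) ≤ ⟨Ξ,(H − μN − hO)Ξ⟩ and SourceSlopeBound give L²·m_L(h) ≥ ⟨Ξ,OΞ⟩/2 −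
[C₂/(4cL²) + g_L(μ)]/(2h) with g_L(μ) = E_sec − μN_L − E₀^{gc}(μ) = o(L²). [deps: SourceSlopeBound]
[difficulty: L] -/
@[route_item "route-HubbardSuperconductivity-OneSidedBootstrap"]
def SourcedOrderDominatesLRO : Prop :=
  ∀ (U μ : ℝ) (N : ℕ → ℕ) (ψ : ∀ L, Literature.MathematicalPhysics.QuantumLattice.Fock (Literature.MathematicalPhysics.QuantumLattice.Orb (Literature.MathematicalPhysics.QuantumLattice.FermionTorus 2 L))), (∀ L, Even L → star (ψ L) ⬝ᵥ ψ L = 1 ∧ Literature.MathematicalPhysics.QuantumLattice.IsGroundStateInSector (Literature.MathematicalPhysics.QuantumLattice.hubbardTorus 2 L 1 U) (N L) 0 (ψ L)) → (∀ ε : ℝ, 0 < ε → ∃ L₀ : ℕ, ∀ L : ℕ, Even L → L₀ ≤ L → |(Literature.MathematicalPhysics.QuantumLattice.hubbardTorus 2 L 1 U).minEnergyOn (Literature.MathematicalPhysics.QuantumLattice.szSector (N L) 0) - μ * (N L : ℝ) - Matrix.groundEnergy (Literature.MathematicalPhysics.QuantumLattice.hubbardTorusWith 2 L 1 U μ)|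 ≤ ε * (L : ℝ) ^ 2) → ∀ c : ℝ, 0 < c → (∃ L₀ : ℕ, ∀ (L : ℕ) [NeZero L], Even L → L₀ ≤ L → c * (L : ℝ) ^ 4 ≤ (Literature.MathematicalPhysics.QuantumLattice.expect (Matrix.conjTranspose (Literature.MathematicalPhysics.QuantumLattice.pairField Literature.MathematicalPhysics.QuantumLattice.dWaveFormFactor L) * Literature.MathematicalPhysics.QuantumLattice.pairField Literature.MathematicalPhysics.QuantumLattice.dWaveFormFactor L) (ψ L)).re) → ∀ h : ℝ, 0 < h → ∀ ε : ℝ, 0 < ε → ∃ L₀ : ℕ, ∀ (L : ℕ) [NeZero L], Even L → L₀ ≤ L → Real.sqrt (c / 2) - ε ≤ Literature.MathematicalPhysics.QuantumLattice.dWaveSourceDensity L U μ h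

-- item stmt-HubbardSuperconductivity-8348 · support · rank 4 · closed · moot by None · by planner — informal only, no Lean statement yet:
--   [crux] StripeOnePointCertificate (route OneSidedBootstrap, rank 4; card K1; CERTIFIED COMPUTATION;
--   needs_definition DWaveOnePointCertificate): there are a level R (target: boxes up to 3×3 / 4×2
--   sites, KKT multipliers of CAR degree ≤ 3–4), h₀ > 0 and a bracket [μ₁, μ₂] containing every
--   canonical supporting potential of (U, δ) = (8, 1/8) (AFQMC: μ ≈ 1.75, Qin et al. arXiv:1910.08931 p.
--   9; a-priori bracket [−4, 12]) such that for all μ ∈ [μ₁, μ₂] and h ∈ (0, h₀): Nonempty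
--   (DWaveOnePointCertificate R 8 μ h (1/20)). With OnePointSoundness and a PotentialBracket lemma this
--   discharges StripeSourceCei

/-- item stmt-HubbardSuperconductivity-8184 · support · rank 9 · closed · moot by None · by planner
sources: KaplanHorschVonDerLinden1989, Griffiths1966, Kato1966, Tasaki2020
[support] for every L, U, μ and h > 0: (groundEnergy (dWaveSourceTorus L U μ 0) − groundEnergy
(dWaveSourceTorus L U μ h))/(2h) ≤ L²·dWaveSourceDensity L U μ h = Re ω₀^{L,h}(P). Proof: h ↦ E_L(h)
= λ_min(H_μ − hO) is concave (infimum of affine functions); its left derivative at h is −λ_min of O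
compressed to the ground space of H_μ − hO (first-order degenerate perturbation theory), which is ≤
the tracial average ω₀^{L,h}(O) = 2 Re ω₀^{L,h}(P); the supergradient inequality gives (E_L(0) −
E_L(h))/h ≤ −E_L′(h−). Abstract matrix lemma worth landing on its own: Hermitian A, O and h > 0 ⇒
(λ_min(A) − λ_min(A − hO))/h ≤ Re (Matrix.groundStateFunctional (A − hO) O). [difficulty:
provable-now] -/
@[route_item "route-HubbardSuperconductivity-OneSidedBootstrap"]
def SourceSlopeBound : Prop :=
  ∀ (L : ℕ) [NeZero L] (U μ h : ℝ), 0 < h → (Matrix.groundEnergy (Literature.MathematicalPhysics.QuantumLattice.dWaveSourceTorus L U μ 0) - Matrix.groundEnergy (Literature.MathematicalPhysics.QuantumLattice.dWaveSourceTorus L U μ h)) / (2 * h) ≤ (L : ℝ) ^ 2 * Literature.MathematicalPhysics.QuantumLattice.dWaveSourceDensity L U μ h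

/-- item stmt-HubbardSuperconductivity-8185 · support · rank 9 · closed · moot by None · by planner
sources: Ruelle1969, Simon1993, Griffiths1966, LiebWu1968
[support] (T = 0 equivalence of ensembles for the Hubbard torus) for every real U and δ ∈ (0,1)
there is μ such that |minEnergyOn (szSector N_L 0) (hubbardTorus 2 L 1 U) − μ·N_L − groundEnergy
(hubbardTorusWith 2 L 1 U μ)| ≤ εL² for all even L ≥ L₀(ε), N_L = 2⌊(1 − δ)L²/2⌋. Proof: existence
of the ground-state energy density e(ρ) = lim E_L(N_L(ρ))/L² (block decomposition of the torus,
boundary hopping costs O(L), sector energies are C-Lipschitz in N), its convexity (two half-tori),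
groundEnergy(H − μN)/L² → min_ρ (e(ρ) − μρ), and μ any subgradient of e at 1 − δ (all subgradients
lie in [−4, 4 + U⁺] since e(0) = 0 with slope −4 at 0⁺ and slope ≤ 4 + U⁺ at 2⁻). The S^z = 0
restriction is immaterial (N_L even ⇒ every spin multiplet of the N_L-sector ground space has an S^z
= 0 member). Library value beyond this route: the canonical ↔ grand-canonical dictionary every
sourced-order-parameter route (WeakCouplingBCS, ChiralWindow, AposterioriCapRg) silently needs.
[difficulty: M] -/
@[route_item "route-HubbardSuperconductivity-OneSidedBootstrap"]
def CanonicalSupportingPotential : Prop :=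
  ∀ (U δ : ℝ), δ ∈ Set.Ioo (0:ℝ) 1 → ∃ μ : ℝ, ∀ ε : ℝ, 0 < ε → ∃ L₀ : ℕ, ∀ L : ℕ, Even L → L₀ ≤ L → |(Literature.MathematicalPhysics.QuantumLattice.hubbardTorus 2 L 1 U).minEnergyOn (Literature.MathematicalPhysics.QuantumLattice.szSector (2 * ⌊(1 - δ) * (L : ℝ) ^ 2 / 2⌋₊) 0) - μ * ((2 * ⌊(1 - δ) * (L : ℝ) ^ 2 / 2⌋₊ : ℕ) : ℝ) - Matrix.groundEnergy (Literature.MathematicalPhysics.QuantumLattice.hubbardTorusWith 2 L 1 U μ)| ≤ ε * (L : ℝ) ^ 2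

/-- item stmt-HubbardSuperconductivity-8186 · support · rank 9 · closed · moot by None · by planner
sources: KomaTasaki1994, KaplanHorschVonDerLinden1989, QinEtAl2020, Literature.Barriers.HubbardSuperconductivity.PureModelStripeCompetition
[support] (the Koma–Tasaki reading of the catalogued stripe no-go, as a theorem schema) if at every
canonical supporting potential μ of (8, 1/8) the sourced d-wave order parameter vanishes in the
finite-volume sense — ∀ η > 0 ∃ h₀ > 0 ∀ h ∈ (0, h₀) ∃ L₀ ∀ L ≥ L₀: dWaveSourceDensity L 8 μ h ≤ η —
then PureModelStripeCompetition (= ¬HasDWavePairFieldLROAt 8 (1/8)) holds; in fact NO admissible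
sequence at (8, 1/8) has d-wave pair-field LRO. Follows from SourcedOrderDominatesLRO +
CanonicalSupportingPotential + the LRO normal form Σ_{x,y∈halfOpenBox 2 (2k)} torusPullback
(pairFieldCorr dWaveFormFactor ψ) (2k) x y = Re⟨ψ_{2k}, P†P ψ_{2k}⟩ + existence of admissible
sequences (Theorems/NoGoNogoThesis exists_groundStateInSector_seq) + liminf ⇒ eventually
bookkeeping. This is the step the barrier entry's scope caveat records as 'assumed, not proved'.
[difficulty: M] -/
@[route_item "route-HubbardSuperconductivity-OneSidedBootstrap"]
def SsbReadingOfStripeNoGo : Prop :=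
  (∀ μ : ℝ, (∀ ε : ℝ, 0 < ε → ∃ L₀ : ℕ, ∀ L : ℕ, Even L → L₀ ≤ L → |(Literature.MathematicalPhysics.QuantumLattice.hubbardTorus 2 L 1 8).minEnergyOn (Literature.MathematicalPhysics.QuantumLattice.szSector (2 * ⌊(1 - 1 / 8) * (L : ℝ) ^ 2 / 2⌋₊) 0) - μ * ((2 * ⌊(1 - 1 / 8) * (L : ℝ) ^ 2 / 2⌋₊ : ℕ) : ℝ) - Matrix.groundEnergy (Literature.MathematicalPhysics.QuantumLattice.hubbardTorusWith 2 L 1 8 μ)| ≤ ε * (L : ℝ) ^ 2) → ∀ η : ℝ, 0 < η → ∃ h₀ : ℝ, 0 < h₀ ∧ ∀ h : ℝ, h ∈ Set.Ioo (0:ℝ) h₀ → ∃ L₀ : ℕ, ∀ (L : ℕ) [NeZero L], L₀ ≤ L → Literature.MathematicalPhysics.QuantumLattice.dWaveSourceDensity L 8 μ h ≤ η) → Literature.Barriers.HubbardSuperconductivity.PureModelStripeCompetition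

-- item stmt-HubbardSuperconductivity-8347 · support · rank 9 · closed · moot by None · by planner — informal only, no Lean statement yet:
--   [support] OnePointSoundness (route OneSidedBootstrap, layer-2 child of StripeSourceCeiling;
--   needs_definition DWaveOnePointCertificate): ∀ R U μ h η, Nonempty (DWaveOnePointCertificate R U μ h
--   η) → ∃ L₀, ∀ L ≥ L₀, Literature.MathematicalPhysics.QuantumLattice.dWaveSourceDensity L U μ h ≤ η.
--   Proof (provable once the definition lands, ~300–600 lines): apply the tracial ground-state
--   functional ω₀ = Matrix.groundStateFunctional (dWaveSourceTorus L U μ h) to the certificate identity;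
--   ω₀(sᴴs) ≥ 0 (groundProj is an orthogonal projection, tr(P sᴴ s P) ≥ 0); ω₀(aᴴ(Ha − aH)) = tr(P_GS aᴴ
--   (H − E₀) a)/tr P

/-- item stmt-HubbardSuperconductivity-8187 · assembly · rank 1 · closed · moot by None · by planner
sources: KomaTasaki1994, KaplanHorschVonDerLinden1989, QinEtAl2020
[assembly] SourcedOrderDominatesLRO → CanonicalSupportingPotential → StripeSourceCeiling →
StripePointCeiling. -/
@[route_item "route-HubbardSuperconductivity-OneSidedBootstrap"]
def Assembly : Prop :=
  SourceSlopeBound → SourcedOrderDominatesLRO → CanonicalSupportingPotential → StripeSourceCeiling → StripePointCeiling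

end Summit.HubbardSuperconductivity.HubbardSuperconductivity.Theses.OneSidedBootstrap
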